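import Literature.AnabelianGeometry.AbsoluteAnabelian.AbsTopIProp410CoFreeBridge
import HarnessLib

/-!
# [AbsTopI] Prop 4.10 (v): row v.L02 (`MaxCompactAreVerticial`) IS node (iv) as typed — the
# by-name bridge to abc-iut-L4-t4's `VerticialEdgeLikeCharacterized` (proof-only)

S. Mochizuki, *Topics in Absolute Anabelian Geometry I: Generalities* [AbsTopI] (J. Math. Sci.
Univ. Tokyo 19 (2012)), Prop 4.10 (iv) p. 60 ("the verticial subgroups [...] of `H[l]` may be
characterized [...] as the maximal compact subgroups") and (v) p. 61; manuscript pagination, lit key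
`paper:url-11ac98ba15fc`, read on the page.  Sub-DAG `HOME/plan/L4/SUBDAG-AbsTopI-Prop410.md`, §C:
the PROVED assembly `prop410v_of_rows` / `prop410vAt_of_rows` (abc-iut-w5-d025, p414417; at the
construction p417235) takes row v.L02 `MaxCompactAreVerticial K R` — "maximal compact ⟺ conjugate of
a verticial subgroup of a vertex of `Γ_H`" — which the table records as "(iv) of the node itself",
typed by abc-iut-L4-t4 as the predicate `VerticialEdgeLikeCharacterized verticial edgeLike` on
abstract data (`AbsTopITemperedCusps.lean`).  The board row "L02-bridge (instantiate t4's (iv)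
predicate at the kit)" is this file: with `verticial := ` the conjugacy-closure of the kit's
verticial subgroups `R.vert H l v`, the verticial half of `VerticialEdgeLikeCharacterized` is
LITERALLY row v.L02 (`maxCompactAreVerticial_iff_characterized`), so node (v) at the construction
follows from node (iv)-as-typed at the reduction-graph kit plus the [SemiAnbd] Cor 3.11 dictionary
rows v.L03–v.L05 (`prop410vAt_of_prop410iv`).  Nothing is asserted about (iv) itself.
HONEST FRAMING: refereed prerequisite paper; nothing here bears on [IUTchIII] Cor 3.12; typed ≠ proved.
-/

noncomputable section

open scoped Pointwise

namespace Literature.AnabelianGeometry.AbsoluteAnabelian.AbsTopI.Prop410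

open Literature.AnabelianGeometry.SemiGraphs
open Literature.AnabelianGeometry.AbsoluteAnabelian.AbsTopI

variable {p : ℕ} [Fact p.Prime]

/-- The verticial family of the reduction-graph kit at `(H, l)`: the `H[l]`-conjugates of the
verticial subgroups `Π_v`, `v` a vertex of `Γ_H` ([AbsTopI] Prop 4.10 (iv): verticial subgroups are
only well defined up to conjugacy) — written inline below as
`{V | ∃ v u, V = MulAut.conj u • R.vert H l v}` (no definition is introduced).
**Row v.L02 at `(H, l)` ⟺ the verticial half of node (iv) as typed by abc-iut-L4-t4** for that
family. [cite: MochizukiAbsTopI2012, Prop 4.10 (iv) p.60] -/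
theorem maxCompactAreVerticial_at_iff {X : TemperedCurve p} (K : CoFreeLKit X)
    (R : ReductionGraphKit X K) (H : Subgroup X.PiTemp) (l : ℕ) :
    (∀ M : Subgroup (K.Hl H l),
        IsMaxCompactSubgroup M ↔ ∃ (v : R.V H) (u : K.Hl H l), M = MulAut.conj u • R.vert H l v) ↔
      {V : Subgroup (K.Hl H l) | ∃ (v : R.V H) (u : K.Hl H l), V = MulAut.conj u • R.vert H l v} =
        {V : Subgroup (K.Hl H l) | IsCompact (V : Set (K.Hl H l)) ∧
          ∀ W : Subgroup (K.Hl H l), IsCompact (W : Set (K.Hl H l)) → V ≤ W → V = W} := by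
  constructor
  · intro h
    ext V
    simp only [Set.mem_setOf_eq]
    exact (h V).symm
  · intro h M
    have hM := Set.ext_iff.mp h M
    simp only [Set.mem_setOf_eq] at hM
    exact hM.symm

/-- **Row v.L02 `MaxCompactAreVerticial K R` ⟺ for every open finite-index `H ⊆ Δ^tp_X` and prime
`l ≠ p`, abc-iut-L4-t4's `VerticialEdgeLikeCharacterized` holds for the kit's verticial family and
SOME edge-like family** (the edge-like half of (iv) is a definition of the edge-like family and
carries no constraint here). [cite: MochizukiAbsTopI2012, Prop 4.10 (iv) p.60] -/
theorem maxCompactAreVerticial_iff_characterized {X : TemperedCurve p} (K : CoFreeLKit X)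
    (R : ReductionGraphKit X K) :
    MaxCompactAreVerticial K R ↔
      ∀ (H : Subgroup X.PiTemp), IsOpenFiniteIndexInDelta X H → ∀ l : ℕ, l.Prime → l ≠ p →
        ∃ edgeLike : Set (Subgroup (K.Hl H l)),
          VerticialEdgeLikeCharacterized
            {V : Subgroup (K.Hl H l) | ∃ (v : R.V H) (u : K.Hl H l), V = MulAut.conj u • R.vert H l v}
            edgeLike := by
  constructor
  · intro h H hH l hl hlp
    refine ⟨_, (maxCompactAreVerticial_at_iff K R H l).mp (h H hH l hl hlp), rfl⟩
  · intro h H hH l hl hlp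
    obtain ⟨edgeLike, hV, -⟩ := h H hH l hl hlp
    exact (maxCompactAreVerticial_at_iff K R H l).mpr hV

/-- **[AbsTopI] Prop 4.10 (v) AT THE CONSTRUCTION from node (iv) as typed** (abc-iut-L4-t4's
`VerticialEdgeLikeCharacterized` for the verticial families of a reduction-graph kit over
`CoFreeLKit.ofConstruction X`) **and the [SemiAnbd] Cor 3.11 dictionary rows v.L03–v.L05**
(`FixesOfOuterTrivial`, `VertexInertiaPPower`, `ExistsInertPCovering`).
[cite: MochizukiAbsTopI2012, Prop 4.10 (v) p.61] -/
theorem prop410vAt_of_prop410iv (X : TemperedCurve p)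
    (R : ReductionGraphKit X (CoFreeLKit.ofConstruction X))
    (h4 : ∀ (H : Subgroup X.PiTemp), IsOpenFiniteIndexInDelta X H → ∀ l : ℕ, l.Prime → l ≠ p →
      ∃ edgeLike : Set (Subgroup ((CoFreeLKit.ofConstruction X).Hl H l)),
        VerticialEdgeLikeCharacterized
          {V : Subgroup ((CoFreeLKit.ofConstruction X).Hl H l) |
            ∃ (v : R.V H) (u : (CoFreeLKit.ofConstruction X).Hl H l),
              V = MulAut.conj u • R.vert H l v}
          edgeLike)
    (h3 : FixesOfOuterTrivial (CoFreeLKit.ofConstruction X) R)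
    (h4' : VertexInertiaPPower (CoFreeLKit.ofConstruction X) R)
    (h5 : ExistsInertPCovering (CoFreeLKit.ofConstruction X) R) : Prop410vAt X :=
  prop410vAt_of_rows X R ((maxCompactAreVerticial_iff_characterized _ R).mpr h4) h3 h4' h5

end Literature.AnabelianGeometry.AbsoluteAnabelian.AbsTopI.Prop410

end
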